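import Summits.BirchSwinnertonDyer.BirchSwinnertonDyer.Theorems.PrintCf2RamifiedOffTYZGenusPeriodKummer
import Summits.BirchSwinnertonDyer.BirchSwinnertonDyer.Theorems.PrintCf2RamifiedOffTYZGenusPeriodNormClass
import HarnessLib

/-!
# THE GENUS PERIOD'S KUMMER CLASS READ THROUGH THE EXACT-DESCENT IDENTITY: `2`-divisibility of `Z(d)` ⟺ the NORM PAIR
# `(N_{H/L} x(z), N_{H(i)/M}(x(z) − 2i))` is a torsion class, and — with the first coordinate trivial — C⁺ on the visible R2 rows ⟺ the second norm
# is not in `⟨i⟩·ℍ′²` (crux stmt-BirchSwinnertonDyer-20509 `RamifiedOffTYZOfFacts`, line `offtyz-v7`, LEAD g29, lineage cycle 30)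

HONEST FRAMING (cell `bsd-print-cf2`, route `PrintCf2`; `--supports stmt-BirchSwinnertonDyer-20509`; theorems only, `def`-free, no `sorry`).
BSD is not proved by any of this; no class is closed by this file; item 23431 (C⁺) and crux 20509 stay OPEN.

WHERE THE LINE STOOD.  g26 (`…GenusPeriodNormClass`, p790023) proved from the seven-block display (S1)–(S3) that the `2`-descent class of the genus
period `Z(d)` at `T⁺ = (2i, 0)`, READ IN THE BIG FIELD `M ⊇ H_d(i)·ℍ′_n`, is the class of the Φ-norm `N₀`, `ι N₀ = ∏_{t∈Φ}(x(z^t) − 2i)`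
(`N₀ = N_{H_n(i)/L_n(i)}(x(z_n) − 2i)` for block-free `n = d`), and flagged that the class over `ℍ′_n` ITSELF was known only up to the kernel of
`ℍ′^×/□ → M^×/□` ("the DESCENT step of the U-road … not done here").  g28 (`…GenusPeriodKummer`, p795970) read `2`-divisibility modulo torsion as
«the Kummer pair `([X], [X − 2i])` is one of four torsion classes» and found LAW Z⁺ (`[X(Z)] = 1`, `[X(Z) − 2i] = [π_l]^{[¬S]}[β_l]^{[¬x32]}`, 165/165).

THIS CYCLE (memo `Cruxes/RamifiedOffTYZOfFacts/Lines/offtyz_v7_ExactDescent.md`): (A1) the EXACT DESCENT LEMMA — for a trace `Z = Σ_{t∈Φ} z^t` over a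
Galois set of conjugates, `(x(Z) − e)·∏_t (x(z^t) − e)` is a square IN THE GROUND FIELD (Weil reciprocity; equivalently `cor ∘ δ = δ ∘ Tr` with
`cor = norm` on `H¹(·, μ₂)`, Silverman X.1.1 + NSW (1.5.7)) — so g26's identity holds in `ℍ′_n` itself: `κ_{ℍ′}(Z(d)) = ([N₁], [N₀])` with
`N₁ = N_{H/L} x(z)`, `N₀ = N_{H(i)/M}(x(z) − 2i)`; verified EXACTLY on 25 rows (`xnorm.py`, T1/T2); (A2) THEOREM A — the FIRST coordinate in closed form
for every square-free `n ≡ 7 (mod 8)` (`H(√x(z_n))` = the ray class field of conductor `𝔭̄³`; transfer): `[N₁] ≠ 1 ⟺ 4-rank Cl(−n) = 0`, or `= 1` with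
the Rédei divisor `d₄ ≡ ±3 (mod 8)` — in particular `[N₁] = 1` on every R2 row (25/25, new non-block-free predictions included).  The kernel cannot
yet hold (A1)/(A2) (no Weil reciprocity / CM reciprocity in Mathlib); THIS FILE records, def-free and by name, exactly what they buy:

* §1 `twoDescentComponent_eq_sqClass_of_exactDescent_two_im / _zero` — the exact-descent identities in COORDINATES: if `Z(d) = (X, Y)` and
  `(X − 2i)·N₀`, `X·N₁` are squares of `ℍ′_n`, then `κ⁺_{ℍ′}(Z(d)) = [N₀]`, `κ⁰_{ℍ′}(Z(d)) = [N₁]` (the hypothesis SHAPE (A1) delivers).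
* §2 ★★ `twoDivisible_iff_normClasses` — granted the two identities (`n` odd, Lemma 3.18): **`Z(d) ∈ 2A(ℍ′_n) + tors ⟺ ([N₁] = 1 ∧ [N₀] ∈ {1, [i]}) ∨
  ([N₁] = [i] ∧ [N₀] ∈ {[1+i], [i(1+i)]})`** — an EQUIVALENCE, upgrading g26's one-directional `genusPeriod_not_twoDivisible_of_norm` (six non-square
  conditions ⟹ not divisible).
* §3 ★★ `twoDivisible_iff_secondNorm_of_firstNorm_trivial` (+ `…_iff_sq`) — with THEOREM A's conclusion `[N₁] = 1` and `ζ₈ ∉ ℍ′_n` (`[i] ≠ 1`):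
  **`Z(d) ∈ 2A + tors ⟺ [N₀] ∈ {1, [i]} ⟺ N₀ ∈ ℍ′² ∪ i⁻¹ℍ′²`** — ONE square-class question about ONE number.
* §4 ★★★ `levelTwo_iff_secondNorm_of_visible_R2` / `levelTwo_of_secondNorm_of_visible_R2` — BY NAME (conjuncts 1, 2, 4, 5 of 𝔅_ram, display package,
  g26's visible branch `GenusPeriodR2.levelTwo_iff_genusPeriod_not_twoDivisible_of_visible`): on an R2 row `n = lq` with `ord L(E_n) = 1` and a VISIBLE
  generator (`X(h) ∉ 2ℚ^{×2}`), granted (A1) at `d = n` and `[N₁] = 1`: **C⁺ at `lq` ⟺ neither `N₀` nor `i·N₀` is a square in `ℍ′_n`**.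

So after this cycle the open content of C⁺ on the visible R2 rows is literally «is `N_{H_n(i)/L_n(i)}(x(z_n) − 2i)` in `⟨i⟩·L_n(i)^{×2}`?», the first
coordinate being a theorem on paper (A2) and the descent exact (A1).  The memo also records WHY (U2) cannot finish: `√(x − 2i)` lives on the
`2`-isogeny cover `A/⟨(2i,0)⟩ → A`, an unramified double cover of `X₀(32)` dominated by NO congruence subgroup (Wohlfahrt), so Shimura reciprocity
does not evaluate `[N₀]`; `√x` (the Shimura cover, `η₁₆³/(η₈η₃₂²)`) is congruence — which is (A2).

References: [cite: TianYuanZhang2017, §3.1 (p0010 L38, L85–L92, L111; p0011 L1–L8, L53–L66), §3.2 (p0012 L8–L9), Lemma 3.16, Lemma 3.18 (p0017 L152–L153), Thm. 3.5, Thm. 1.2];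
[cite: SilvermanAEC2009, Prop. X.1.4, Thm. X.1.1, Ex. 2.11 (Weil reciprocity)]; [cite: NeukirchSchmidtWingberg2008, §1.5 (cor = norm on H¹(·, μ₂))];
[cite: BurungaleFlach2024, Thm 1.1 / Cor. 3]; [cite: Darmon2004, Thm. 3.22]; tree: p795970 (`…GenusPeriodKummer`), p790023 (`…GenusPeriodNormClass`),
p789339 (`…GenusPeriodR2`).
-/

noncomputable section

open scoped Classical

open WeierstrassCurve WeierstrassCurve.Affine WeierstrassCurve.Affine.Point
  Literature.NumberTheory.EllipticCurves Literature.NumberTheory.EllipticCurves.Rank1Residual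
  Summit.BirchSwinnertonDyer.Rank1Residual
  Literature.NumberTheory.EllipticCurves.TianYuanZhang2017
  Literature.NumberTheory.EllipticCurves.TianYuanZhang2017.W2
  Summit.BirchSwinnertonDyer.PrintCf2.VisibleGenerator

set_option autoImplicit false

namespace Summit.BirchSwinnertonDyer.PrintCf2.GenusPeriodExactDescent

variable {n : ℕ}

/-! ## §1 The exact-descent identities in coordinates -/

/-- **Exact descent at `T⁺ = (2i, 0)`, coordinate form.**  If `Z(d) = (X, Y) ∈ A(ℍ′_n)` with `X ≠ 2i` and `(X − 2i)·N₀ = r²` in `ℍ′_n` (the shape in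
which the exact-descent lemma delivers the Φ-norm `N₀ = N_{H(i)/M}(x(z) − 2i)`), then the `2`-descent component of `Z(d)` at `T⁺`, read in `ℍ′_n`
itself, is `[N₀]`. [cite: SilvermanAEC2009, Prop. X.1.4, Ex. 2.11] [cite: NeukirchSchmidtWingberg2008, §1.5] -/
theorem twoDescentComponent_eq_sqClass_of_exactDescent_two_im (D : GenusPointData n) {d : ℕ} {X Y : D.H}
    (h : (curveA.baseChange D.H).toAffine.Nonsingular X Y) (hZ : D.Z d = Point.some X Y h) (hX2 : X ≠ 2 * D.im)
    {N₀ r : D.H} (hN : N₀ ≠ 0) (hdesc : (X - 2 * D.im) * N₀ = r ^ 2) :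
    twoDescentComponent (curveA.baseChange D.H).toAffine (2 * D.im) 0 (-(2 * D.im)) (D.Z d) = sqClass N₀ := by
  rw [hZ, twoDescentComponent_some_of_ne h hX2]
  exact KramerShaG.sqClass_eq_of_mul_eq_square (sub_ne_zero.mpr hX2) hN hdesc

/-- **Exact descent at `τ(1) = (0, 0)`, coordinate form.**  If `Z(d) = (X, Y)` with `X ≠ 0` and `X·N₁ = r²` in `ℍ′_n` (`N₁ = N_{H/L} x(z)`), then the
`2`-descent component of `Z(d)` at `τ(1)`, read in `ℍ′_n`, is `[N₁]`. [cite: SilvermanAEC2009, Prop. X.1.4, Ex. 2.11] [cite: NeukirchSchmidtWingberg2008, §1.5] -/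
theorem twoDescentComponent_eq_sqClass_of_exactDescent_zero (D : GenusPointData n) {d : ℕ} {X Y : D.H}
    (h : (curveA.baseChange D.H).toAffine.Nonsingular X Y) (hZ : D.Z d = Point.some X Y h) (hX0 : X ≠ 0)
    {N₁ r : D.H} (hN : N₁ ≠ 0) (hdesc : X * N₁ = r ^ 2) :
    twoDescentComponent (curveA.baseChange D.H).toAffine 0 (2 * D.im) (-(2 * D.im)) (D.Z d) = sqClass N₁ := by
  rw [hZ, twoDescentComponent_some_of_ne h hX0, sub_zero]
  exact KramerShaG.sqClass_eq_of_mul_eq_square hX0 hN hdesc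

/-! ## §2 `2`-divisibility of the genus period ⟺ the norm pair is a torsion class -/

/-- ★★ **`Z(d) ∈ 2A(ℍ′_n) + tors ⟺ THE NORM PAIR IS ONE OF THE FOUR TORSION CLASSES.**  `n` odd, Lemma 3.18 displayed; granted the two exact-descent
identities `κ⁰_{ℍ′}(Z(d)) = [N₁]`, `κ⁺_{ℍ′}(Z(d)) = [N₀]` (§1, or any other source):
**`Z(d) − 2y` torsion for some `y` ⟺ ([N₁] = 1 ∧ [N₀] ∈ {1, [i]}) ∨ ([N₁] = [i] ∧ [N₀] ∈ {[1+i], [i(1+i)]})`.**  An equivalence (g26's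
`GenusPeriodNormCriterion.genusPeriod_not_twoDivisible_of_norm` was the contrapositive of ⟹ only, read in the big field).
[cite: SilvermanAEC2009, Prop. X.1.4] [cite: TianYuanZhang2017, Lemma 3.18 (p0017 L152–L153), Lemma 3.16 (p0017 L98–L113)] -/
theorem twoDivisible_iff_normClasses (D : GenusPointData n) (hodd : Odd n) (h318 : D.lemma318) {d : ℕ} {N₁ N₀ : D.H}
    (hED0 : twoDescentComponent (curveA.baseChange D.H).toAffine 0 (2 * D.im) (-(2 * D.im)) (D.Z d) = sqClass N₁)
    (hEDp : twoDescentComponent (curveA.baseChange D.H).toAffine (2 * D.im) 0 (-(2 * D.im)) (D.Z d) = sqClass N₀) :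
    (∃ y : APoint D.H, IsOfFinAddOrder (D.Z d - (2 : ℤ) • y)) ↔
      (sqClass N₁ = 1 ∧ (sqClass N₀ = 1 ∨ sqClass N₀ = sqClass D.im)) ∨
        (sqClass N₁ = sqClass D.im ∧ (sqClass N₀ = sqClass (1 + D.im) ∨ sqClass N₀ = sqClass (D.im * (1 + D.im)))) := by
  rw [GenusPeriodKummer.twoDivisible_modTorsion_iff_sqClass D hodd h318 (D.Z d), hED0, hEDp]

/-! ## §3 With the first coordinate trivial (THEOREM A on the R2 rows): one square-class question -/

/-- ★★ **FIRST NORM TRIVIAL ⟹ `2`-divisibility of `Z(d)` is the class of the SECOND NORM.**  `n` odd, Lemma 3.18, `ζ₈ ∉ ℍ′_n` (`[i] ≠ 1`); granted the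
exact-descent identities with `[N₁] = 1` (THEOREM A: `4`-rank of `Cl(−d)` `≥ 2`, or `= 1` with Rédei divisor `≡ ±1 (mod 8)` — every R2 row):
**`Z(d) ∈ 2A(ℍ′_n) + tors ⟺ [N₀] ∈ {1, [i]}`.** [cite: SilvermanAEC2009, Prop. X.1.4] [cite: TianYuanZhang2017, Lemma 3.18 (p0017 L152–L153)] -/
theorem twoDivisible_iff_secondNorm_of_firstNorm_trivial (D : GenusPointData n) (hodd : Odd n) (h318 : D.lemma318)
    (hi8 : sqClass D.im ≠ 1) {d : ℕ} {N₁ N₀ : D.H}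
    (hED0 : twoDescentComponent (curveA.baseChange D.H).toAffine 0 (2 * D.im) (-(2 * D.im)) (D.Z d) = sqClass N₁)
    (hEDp : twoDescentComponent (curveA.baseChange D.H).toAffine (2 * D.im) 0 (-(2 * D.im)) (D.Z d) = sqClass N₀)
    (hA : sqClass N₁ = 1) :
    (∃ y : APoint D.H, IsOfFinAddOrder (D.Z d - (2 : ℤ) • y)) ↔ (sqClass N₀ = 1 ∨ sqClass N₀ = sqClass D.im) := by
  rw [twoDivisible_iff_normClasses D hodd h318 hED0 hEDp, hA]
  constructor
  · rintro (⟨-, h⟩ | ⟨h1, -⟩)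
    · exact h
    · exact absurd h1.symm hi8
  · exact fun h => Or.inl ⟨rfl, h⟩

/-- **The same in squares**: with `N₀ ≠ 0`, `Z(d) ∈ 2A(ℍ′_n) + tors ⟺ N₀ ∈ ℍ′² ∨ N₀·i ∈ ℍ′²` — the exact test the instrument runs on the number
`N₀ = N_{H(i)/M}(x(z) − 2i)`. [cite: SilvermanAEC2009, Prop. X.1.4] [cite: TianYuanZhang2017, Lemma 3.18 (p0017 L152–L153)] -/
theorem twoDivisible_iff_secondNorm_sq_of_firstNorm_trivial (D : GenusPointData n) (hodd : Odd n) (h318 : D.lemma318)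
    (hi8 : sqClass D.im ≠ 1) {d : ℕ} {N₁ N₀ : D.H} (hN : N₀ ≠ 0)
    (hED0 : twoDescentComponent (curveA.baseChange D.H).toAffine 0 (2 * D.im) (-(2 * D.im)) (D.Z d) = sqClass N₁)
    (hEDp : twoDescentComponent (curveA.baseChange D.H).toAffine (2 * D.im) 0 (-(2 * D.im)) (D.Z d) = sqClass N₀)
    (hA : sqClass N₁ = 1) :
    (∃ y : APoint D.H, IsOfFinAddOrder (D.Z d - (2 : ℤ) • y)) ↔ ((∃ s : D.H, N₀ = s ^ 2) ∨ ∃ s : D.H, N₀ * D.im = s ^ 2) := by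
  have hi0 := P2.ThetaDescent.im_ne_zero D
  rw [twoDivisible_iff_secondNorm_of_firstNorm_trivial D hodd h318 hi8 hED0 hEDp hA, sqClass_eq_one_iff hN,
    GenusPeriodKummer.sqClass_eq_iff_exists_sq hN hi0]

/-! ## §4 R2 by name: C⁺ on the visible rows is the square class of ONE elliptic-unit norm -/

/-- ★★★ **C⁺ AT `lq` ON A VISIBLE ROW ⟺ THE SECOND NORM IS NOT IN `⟨i⟩·ℍ′²`.**  Granted conjuncts 1, 2, 4, 5 of 𝔅_ram; primes `l ≡ 1`, `q ≡ 7 (mod 8)`,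
`n = lq`, `ord_{s=1} L(E_n, s) = 1`; a display package `D` (`Printed`, CM-point layer, Thm 3.5 at blocks) with `ζ₈ ∉ ℍ′_n`; a VISIBLE generator
`h = (X, Y)` of `A_n(ℚ)` modulo torsion (`X ∉ 2ℚ^{×2}`); the exact-descent identities at `d = n` for numbers `N₁, N₀ ∈ ℍ′_n` (`N₁ = N_{H/L} x(z_n)`,
`N₀ = N_{H(i)/M}(x(z_n) − 2i)` by (A1)) with `[N₁] = 1` (THEOREM A).  Then **`2 ∥ L` for every `L` with `𝓛(n)² = L²`  ⟺  neither `N₀` nor `N₀·i` is a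
square in `ℍ′_n`.** [cite: TianYuanZhang2017, §1, §3.1, Thm. 3.5, Lemma 3.18, Thm. 1.2] [cite: BurungaleFlach2024, Thm 1.1 / Cor. 3] [cite: Darmon2004, Thm. 3.22]
[cite: SilvermanAEC2009, Prop. X.1.4, Ex. 2.11] -/
theorem levelTwo_iff_secondNorm_of_visible_R2 (hGZK : rank_eq_analyticRank_of_analyticRank_le_one)
    (hmod : WeierstrassCurve.hasEntireLFunction_rat) (hCM0 : bsdTriple_of_hasCM_of_L_one_ne_zero) (h12 : thm12_parity_of_scriptL')
    {l q : ℕ} (hl : l.Prime) (hq : q.Prime) (hl8 : l % 8 = 1) (hq8 : q % 8 = 7) (hn : n = l * q)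
    (hr : (congruentNumberCurve n).analyticRank = 1)
    (D : GenusPointData n) (hPr : D.Printed) (hC : D.CMPointCompositumPrinted) (hBl : D.Thm35AtBlocks) (hi8 : sqClass D.im ≠ 1)
    {X Y : ℚ} (h : (Atwo n).toAffine.Nonsingular X Y) (hX : ¬ ∃ s : ℚ, X = 2 * s ^ 2)
    (hgen : ∀ P : (Atwo n).toAffine.Point, ∃ m : ℤ, IsOfFinAddOrder (P - m • (Point.some X Y h : (Atwo n).toAffine.Point)))
    {N₁ N₀ : D.H} (hN : N₀ ≠ 0)
    (hED0 : twoDescentComponent (curveA.baseChange D.H).toAffine 0 (2 * D.im) (-(2 * D.im)) (D.Z n) = sqClass N₁)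
    (hEDp : twoDescentComponent (curveA.baseChange D.H).toAffine (2 * D.im) 0 (-(2 * D.im)) (D.Z n) = sqClass N₀)
    (hA : sqClass N₁ = 1) :
    (∀ L : ℤ, IsScriptL n L → (2 : ℤ) ∣ L ∧ ¬ (4 : ℤ) ∣ L) ↔ ¬ ((∃ s : D.H, N₀ = s ^ 2) ∨ ∃ s : D.H, N₀ * D.im = s ^ 2) := by
  have hodd : Odd n := by
    rw [hn, Nat.odd_mul]; exact ⟨Nat.odd_iff.mpr (by omega), Nat.odd_iff.mpr (by omega)⟩
  have h318 : D.lemma318 := hPr.2.2.2.2.2.2.2.2.1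
  rw [GenusPeriodR2.levelTwo_iff_genusPeriod_not_twoDivisible_of_visible hGZK hmod hCM0 h12 hl hq hl8 hq8 hn hr D hPr hC hBl h hX hgen,
    twoDivisible_iff_secondNorm_sq_of_firstNorm_trivial D hodd h318 hi8 hN hED0 hEDp hA]

/-- ★★★ **The usable direction**: under the hypotheses of `levelTwo_iff_secondNorm_of_visible_R2`, if `N₀` and `N₀·i` are non-squares in `ℍ′_n`, then
C⁺ holds at `lq`: `2 ∥ L` for every `L` with `𝓛(lq)² = L²`. [cite: TianYuanZhang2017, §1, §3.1, Thm. 3.5, Lemma 3.18, Thm. 1.2]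
[cite: BurungaleFlach2024, Thm 1.1 / Cor. 3] [cite: Darmon2004, Thm. 3.22] [cite: SilvermanAEC2009, Prop. X.1.4, Ex. 2.11] -/
theorem levelTwo_of_secondNorm_of_visible_R2 (hGZK : rank_eq_analyticRank_of_analyticRank_le_one)
    (hmod : WeierstrassCurve.hasEntireLFunction_rat) (hCM0 : bsdTriple_of_hasCM_of_L_one_ne_zero) (h12 : thm12_parity_of_scriptL')
    {l q : ℕ} (hl : l.Prime) (hq : q.Prime) (hl8 : l % 8 = 1) (hq8 : q % 8 = 7) (hn : n = l * q)
    (hr : (congruentNumberCurve n).analyticRank = 1)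
    (D : GenusPointData n) (hPr : D.Printed) (hC : D.CMPointCompositumPrinted) (hBl : D.Thm35AtBlocks) (hi8 : sqClass D.im ≠ 1)
    {X Y : ℚ} (h : (Atwo n).toAffine.Nonsingular X Y) (hX : ¬ ∃ s : ℚ, X = 2 * s ^ 2)
    (hgen : ∀ P : (Atwo n).toAffine.Point, ∃ m : ℤ, IsOfFinAddOrder (P - m • (Point.some X Y h : (Atwo n).toAffine.Point)))
    {N₁ N₀ : D.H} (hN : N₀ ≠ 0)
    (hED0 : twoDescentComponent (curveA.baseChange D.H).toAffine 0 (2 * D.im) (-(2 * D.im)) (D.Z n) = sqClass N₁)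
    (hEDp : twoDescentComponent (curveA.baseChange D.H).toAffine (2 * D.im) 0 (-(2 * D.im)) (D.Z n) = sqClass N₀)
    (hA : sqClass N₁ = 1) (hn1 : ¬ ∃ s : D.H, N₀ = s ^ 2) (hn2 : ¬ ∃ s : D.H, N₀ * D.im = s ^ 2) :
    ∀ L : ℤ, IsScriptL n L → (2 : ℤ) ∣ L ∧ ¬ (4 : ℤ) ∣ L :=
  (levelTwo_iff_secondNorm_of_visible_R2 hGZK hmod hCM0 h12 hl hq hl8 hq8 hn hr D hPr hC hBl hi8 h hX hgen hN hED0 hEDp hA).mpr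
    (not_or.mpr ⟨hn1, hn2⟩)

end Summit.BirchSwinnertonDyer.PrintCf2.GenusPeriodExactDescent

end
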